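import Mathlib
import HarnessLib
import Literature.Analysis.FluidPDE.VectorCalculus
import Literature.Analysis.FluidPDE.VorticityCalculus
import Literature.Analysis.FluidPDE.TypeIAncientMild
import Summits.NavierStokesRegularity.NavierStokesRegularity.Theorems.PoloidalWindowDoorPoloidalWindowRigidityWindow
import Summits.NavierStokesRegularity.NavierStokesRegularity.Theorems.PoloidalWindowDoorPoloidalWindowRigidityFirstIntegral
import Summits.NavierStokesRegularity.NavierStokesRegularity.Theorems.PoloidalWindowDoorPoloidalWindowRigidityVelocityGradientLaw
import Summits.NavierStokesRegularity.NavierStokesRegularity.Theorems.PoloidalWindowDoorPoloidalWindowRigiditySeparatedPressure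
import Summits.NavierStokesRegularity.NavierStokesRegularity.Theorems.PoloidalWindowDoorPoloidalWindowRigidityMaterialLeibniz

/-!
# Route `PoloidalWindowDoor`, crux `PoloidalWindowRigidity` (K2, stmt-NavierStokesRegularity-19708) —
# THE CLEBSCH-SLOPE LAW (★★) IN THE KERNEL, polynomial form with the residual kept

Cell ns-regularity-ideate, seat ns-poloidal-K2-p3 (stub-worker, gen 2; support theorems `--supports` the crux,
`--as helper`).  K2 lead's identity (★★) (K2P1-S2-NOTES §4, kit-certified j259272 `lamlaw.py`): for a poloidal profile,
with `L₀ = ∂ₜ + v·∇ − Δ`, Clebsch slope `Λ` (`∇_h v₂ = Λ∇_hψ`) and residual `f = ∂ₜv + (v·∇)v − Δv` (`= −∇p`),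
`(L₀Λ)∇_hψ − 2(∇Λ·∇)∇_hψ = ∇_h f₂ − ΛJ(curl f)_h`; for the class `curl f = 0`, and dotting with `∇_hψ` gives the scalar
law `|ω|² L₀Λ − ∇Λ·∇|ω|² = ∇_h f₂·∇_hψ`, source-free exactly on the separated-pressure stratum.

Kernel form (no division by `|ω|²`, valid at EVERY point, indices `0,1` horizontal, `2` vertical, `ωₐ = (curl v)ₐ`,
`Xₐ = ∂ₐv₂`): with the smooth scalars
  `N := X₀ω₁ − X₁ω₀`  (`= ⟨J∇_h v₂, ω_h⟩ = −Λ|ω_h|²`)   and   `D := ω₀² + ω₁²`  (`= |ω_h|² = |∇_hψ|²`),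
`𝓛θ := deriv (θ · x) t + D(θ t)(x)[v(t,x)] − Δ(θ t)(x)` and `∂ₖ` the slice partials,
**`D²·𝓛N − N·D·𝓛D + Σₖ ∂ₖD (D ∂ₖN − N ∂ₖD) = D²·(ω₁ (∂₀f)₂ − ω₀ (∂₁f)₂)`**   (`slopeLaw`),
which where `D ≠ 0` is `D³·[L₀(N/D) − ∇(N/D)·∇D/D] = D²·⟨ω_h, J∇_h f₂⟩`, i.e. (★★) dotted with `∇_hψ`; and on the
separated-pressure stratum (`(∂ₐf)₂ = 0` for horizontal `a`) the right-hand side vanishes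
(`slopeLaw_of_separatedPressure`): K2-p1's source-free law `|ω|²(∂ₜ + v·∇)Λ = div(|ω|²∇Λ)` multiplied out.
Inputs: the ω_h-law and the rotated-gradient law with residual (this seat, `…SeparatedPressure`, `…MaterialLeibniz`),
the frozen constraint `ω₀X₀ + ω₁X₁ ≡ 0` (nsreg-p6 `stub_firstIntegral`) and its slice derivatives, the Leibniz
calculus of `…MaterialLeibniz`, and one polynomial certificate (kit j263750: the difference of the two sides equals
`c·(ω₀X₀ + ω₁X₁) − 2D Σₖ βₖ·∂ₖ(ω₀X₀ + ω₁X₁)` with explicit polynomial `c`, `βₖ = ω₀∂ₖω₁ − ω₁∂ₖω₀`, checked by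
`linear_combination`).

WHAT THIS IS NOT: not a claim about Navier–Stokes regularity and not the open residue S2′ — an identity of the poloidal
class (bears_on LADDER-NS N0, rung N0-LocalTubeDoorPoloidal); the H4c gap (K2P1-S2-NOTES §4bis(c)) is untouched.
-/

noncomputable section

-- the summit and its single sub-problem share the name (CONVENTIONS §1), as in every Theorems file
set_option linter.dupNamespace false

namespace Summit.NavierStokesRegularity.NavierStokesRegularity.Theorems.PoloidalWindowDoorPoloidalWindowRigiditySlopeLaw

open MeasureTheory Set Function Filter Topology TopologicalSpace Metric InnerProductSpace
open scoped RealInnerProductSpace InnerProductSpace Laplacian ContDiff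
open Literature.Analysis Literature.Analysis.FluidPDE
open Summit.NavierStokesRegularity.NavierStokesRegularity.Theorems.PoloidalWindowDoorPoloidalWindowRigidityWindow
open Summit.NavierStokesRegularity.NavierStokesRegularity.Theorems.PoloidalWindowDoorPoloidalWindowRigidityFirstIntegral
open Summit.NavierStokesRegularity.NavierStokesRegularity.Theorems.PoloidalWindowDoorPoloidalWindowRigidityVelocityGradientLaw
open Summit.NavierStokesRegularity.NavierStokesRegularity.Theorems.PoloidalWindowDoorPoloidalWindowRigiditySeparatedPressure
open Summit.NavierStokesRegularity.NavierStokesRegularity.Theorems.PoloidalWindowDoorPoloidalWindowRigidityMaterialLeibniz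

variable {C : ℝ} {v : ℝ → EuclideanSpace ℝ (Fin 3) → EuclideanSpace ℝ (Fin 3)}

/-! ### Two more Leibniz rules (subtraction) -/

/-- Subtractivity of the scalar material operator. -/
theorem material_sub {θ₁ θ₂ : ℝ → EuclideanSpace ℝ (Fin 3) → ℝ} {t : ℝ} {x : EuclideanSpace ℝ (Fin 3)}
    (V : EuclideanSpace ℝ (Fin 3))
    (h1t : DifferentiableAt ℝ (fun s => θ₁ s x) t) (h2t : DifferentiableAt ℝ (fun s => θ₂ s x) t)
    (h1x : ContDiff ℝ 2 (θ₁ t)) (h2x : ContDiff ℝ 2 (θ₂ t)) :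
    deriv (fun s => θ₁ s x - θ₂ s x) t + fderiv ℝ (fun y => θ₁ t y - θ₂ t y) x V
        - Δ (fun y => θ₁ t y - θ₂ t y) x =
      (deriv (fun s => θ₁ s x) t + fderiv ℝ (θ₁ t) x V - Δ (θ₁ t) x)
        - (deriv (fun s => θ₂ s x) t + fderiv ℝ (θ₂ t) x V - Δ (θ₂ t) x) := by
  have hd1 : DifferentiableAt ℝ (θ₁ t) x := (h1x.differentiable (by norm_num)) x
  have hd2 : DifferentiableAt ℝ (θ₂ t) x := (h2x.differentiable (by norm_num)) x
  have hΔ : Δ (fun y => θ₁ t y - θ₂ t y) x = Δ (θ₁ t) x - Δ (θ₂ t) x := by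
    have hfun : (fun y => θ₁ t y - θ₂ t y) = θ₁ t - θ₂ t := by funext y; rfl
    rw [hfun, (h1x.contDiffAt.of_le le_rfl).laplacian_sub (h2x.contDiffAt.of_le le_rfl)]
  rw [deriv_fun_sub h1t h2t, fderiv_fun_sub hd1 hd2, hΔ]
  simp only [_root_.sub_apply]
  ring

/-- Spatial subtractivity in coordinates. -/
theorem fderiv_sub_coord {g₁ g₂ : EuclideanSpace ℝ (Fin 3) → ℝ} {x : EuclideanSpace ℝ (Fin 3)}
    (h1 : DifferentiableAt ℝ g₁ x) (h2 : DifferentiableAt ℝ g₂ x) (w : EuclideanSpace ℝ (Fin 3)) :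
    fderiv ℝ (fun y => g₁ y - g₂ y) x w = fderiv ℝ g₁ x w - fderiv ℝ g₂ x w := by
  rw [fderiv_fun_sub h1 h2]
  simp only [_root_.sub_apply]

/-! ### The slope law -/

/-- **THE CLEBSCH-SLOPE LAW, polynomial kernel form (general poloidal profile, residual kept).**  For a profile of
the route's Type-I class, poloidal along `e₃`, at every `t < 0` and `x`, with `ωₐ(s,y) = (curl v(s))ₐ(y)`,
`Xₐ(s,y) = (∂ₐ v₂)(s,y)`, `N = X₀ω₁ − X₁ω₀`, `D = ω₀² + ω₁²` (as functions of `(s,y)`), `𝓛` the scalar material operator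
at `(t,x)` and `f = ∂ₜv + (v·∇)v − Δv` the intrinsic residual of the slice `t`:
`D² 𝓛N − N D 𝓛D + Σₖ ∂ₖD (D ∂ₖN − N ∂ₖD) = D² (ω₁ (∂₀f)₂ − ω₀ (∂₁f)₂)`. -/
theorem slopeLaw (hrate : HasTypeITimeDecay C v)
    (hcont : ContinuousOn (uncurry v) (Iio (0 : ℝ) ×ˢ univ))
    (hmild : ∀ s t : ℝ, s < t → t < 0 → ∀ x,
      v t x = UnboundedOperators.heatExtension (v s) (t - s) x - oseenDuhamel 1 s v v t x)
    (hdiv : ∀ t < 0, VectorCalculus.IsDivFree (v t))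
    (hpol : ∀ s < 0, ∀ y, ⟪curl (v s) y, EuclideanSpace.single 2 1⟫_ℝ = 0) {t : ℝ} (ht : t < 0)
    (x : EuclideanSpace ℝ (Fin 3)) (W₀ W₁ X₀ X₁ N D : ℝ → EuclideanSpace ℝ (Fin 3) → ℝ)
    (hW₀ : ∀ s y, W₀ s y = curl (v s) y 0) (hW₁ : ∀ s y, W₁ s y = curl (v s) y 1)
    (hX₀ : ∀ s y, X₀ s y = fderiv ℝ (v s) y (EuclideanSpace.single 0 1) 2)
    (hX₁ : ∀ s y, X₁ s y = fderiv ℝ (v s) y (EuclideanSpace.single 1 1) 2)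
    (hN : ∀ s y, N s y = X₀ s y * W₁ s y - X₁ s y * W₀ s y)
    (hD : ∀ s y, D s y = W₀ s y * W₀ s y + W₁ s y * W₁ s y) :
    D t x ^ 2 * (deriv (fun s => N s x) t + fderiv ℝ (N t) x (v t x) - Δ (N t) x)
      - N t x * D t x * (deriv (fun s => D s x) t + fderiv ℝ (D t) x (v t x) - Δ (D t) x)
      + ∑ k : Fin 3, fderiv ℝ (D t) x (EuclideanSpace.single k 1) *
          (D t x * fderiv ℝ (N t) x (EuclideanSpace.single k 1) - N t x * fderiv ℝ (D t) x (EuclideanSpace.single k 1)) =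
    D t x ^ 2 * (W₁ t x * fderiv ℝ (fun y => timeDerivWithin (Iio 0) v t y + convect (v t) (v t) y - Δ (v t) y) x
          (EuclideanSpace.single 0 1) 2 -
        W₀ t x * fderiv ℝ (fun y => timeDerivWithin (Iio 0) v t y + convect (v t) (v t) y - Δ (v t) y) x
          (EuclideanSpace.single 1 1) 2) := by
  -- ## normalise the named scalars to their defining lambdas
  obtain rfl : W₀ = fun s y => curl (v s) y 0 := funext fun s => funext fun y => hW₀ s y
  obtain rfl : W₁ = fun s y => curl (v s) y 1 := funext fun s => funext fun y => hW₁ s y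
  obtain rfl : X₀ = fun s y => fderiv ℝ (v s) y (EuclideanSpace.single 0 1) 2 := funext fun s => funext fun y => hX₀ s y
  obtain rfl : X₁ = fun s y => fderiv ℝ (v s) y (EuclideanSpace.single 1 1) 2 := funext fun s => funext fun y => hX₁ s y
  obtain rfl : N = fun s y => fderiv ℝ (v s) y (EuclideanSpace.single 0 1) 2 * curl (v s) y 1 -
      fderiv ℝ (v s) y (EuclideanSpace.single 1 1) 2 * curl (v s) y 0 := funext fun s => funext fun y => hN s y
  obtain rfl : D = fun s y => curl (v s) y 0 * curl (v s) y 0 + curl (v s) y 1 * curl (v s) y 1 :=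
    funext fun s => funext fun y => hD s y
  beta_reduce
  -- ## regularity of the atoms
  have hW0t := differentiableAt_curl_slice_coord hrate hcont hmild hdiv ht x 0
  have hW1t := differentiableAt_curl_slice_coord hrate hcont hmild hdiv ht x 1
  have hX0t := differentiableAt_fderiv_slice_coord hrate hcont hmild hdiv ht x (EuclideanSpace.single 0 1) 2
  have hX1t := differentiableAt_fderiv_slice_coord hrate hcont hmild hdiv ht x (EuclideanSpace.single 1 1) 2
  have hW0x : ContDiff ℝ 2 (fun y => curl (v t) y 0) := contDiff_curl_coord hrate hcont hmild hdiv ht 0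
  have hW1x : ContDiff ℝ 2 (fun y => curl (v t) y 1) := contDiff_curl_coord hrate hcont hmild hdiv ht 1
  have hX0x : ContDiff ℝ 2 (fun y => fderiv ℝ (v t) y (EuclideanSpace.single 0 1) 2) :=
    (contDiff_fderiv_coord hrate hcont hmild hdiv ht (EuclideanSpace.single 0 1) 2).of_le (by norm_cast)
  have hX1x : ContDiff ℝ 2 (fun y => fderiv ℝ (v t) y (EuclideanSpace.single 1 1) 2) :=
    (contDiff_fderiv_coord hrate hcont hmild hdiv ht (EuclideanSpace.single 1 1) 2).of_le (by norm_cast)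
  have dW0 : DifferentiableAt ℝ (fun y => curl (v t) y 0) x := (hW0x.differentiable (by norm_num)) x
  have dW1 : DifferentiableAt ℝ (fun y => curl (v t) y 1) x := (hW1x.differentiable (by norm_num)) x
  have dX0 : DifferentiableAt ℝ (fun y => fderiv ℝ (v t) y (EuclideanSpace.single 0 1) 2) x :=
    (hX0x.differentiable (by norm_num)) x
  have dX1 : DifferentiableAt ℝ (fun y => fderiv ℝ (v t) y (EuclideanSpace.single 1 1) 2) x :=
    (hX1x.differentiable (by norm_num)) x
  -- ## Leibniz expansions of 𝓛N, 𝓛D, ∂ₖN, ∂ₖD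
  have hLN : deriv (fun s => fderiv ℝ (v s) x (EuclideanSpace.single 0 1) 2 * curl (v s) x 1 -
        fderiv ℝ (v s) x (EuclideanSpace.single 1 1) 2 * curl (v s) x 0) t
      + fderiv ℝ (fun y => fderiv ℝ (v t) y (EuclideanSpace.single 0 1) 2 * curl (v t) y 1 -
        fderiv ℝ (v t) y (EuclideanSpace.single 1 1) 2 * curl (v t) y 0) x (v t x)
      - Δ (fun y => fderiv ℝ (v t) y (EuclideanSpace.single 0 1) 2 * curl (v t) y 1 -
        fderiv ℝ (v t) y (EuclideanSpace.single 1 1) 2 * curl (v t) y 0) x =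
      (fderiv ℝ (v t) x (EuclideanSpace.single 0 1) 2 *
          (deriv (fun s => curl (v s) x 1) t + fderiv ℝ (fun y => curl (v t) y 1) x (v t x) - Δ (fun y => curl (v t) y 1) x)
        + curl (v t) x 1 *
          (deriv (fun s => fderiv ℝ (v s) x (EuclideanSpace.single 0 1) 2) t
            + fderiv ℝ (fun y => fderiv ℝ (v t) y (EuclideanSpace.single 0 1) 2) x (v t x)
            - Δ (fun y => fderiv ℝ (v t) y (EuclideanSpace.single 0 1) 2) x)
        - 2 * ∑ i : Fin 3, fderiv ℝ (fun y => fderiv ℝ (v t) y (EuclideanSpace.single 0 1) 2) x (EuclideanSpace.single i 1) *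
            fderiv ℝ (fun y => curl (v t) y 1) x (EuclideanSpace.single i 1))
      - (fderiv ℝ (v t) x (EuclideanSpace.single 1 1) 2 *
          (deriv (fun s => curl (v s) x 0) t + fderiv ℝ (fun y => curl (v t) y 0) x (v t x) - Δ (fun y => curl (v t) y 0) x)
        + curl (v t) x 0 *
          (deriv (fun s => fderiv ℝ (v s) x (EuclideanSpace.single 1 1) 2) t
            + fderiv ℝ (fun y => fderiv ℝ (v t) y (EuclideanSpace.single 1 1) 2) x (v t x)
            - Δ (fun y => fderiv ℝ (v t) y (EuclideanSpace.single 1 1) 2) x)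
        - 2 * ∑ i : Fin 3, fderiv ℝ (fun y => fderiv ℝ (v t) y (EuclideanSpace.single 1 1) 2) x (EuclideanSpace.single i 1) *
            fderiv ℝ (fun y => curl (v t) y 0) x (EuclideanSpace.single i 1)) := by
    have e1 := material_sub (θ₁ := fun s y => fderiv ℝ (v s) y (EuclideanSpace.single 0 1) 2 * curl (v s) y 1)
      (θ₂ := fun s y => fderiv ℝ (v s) y (EuclideanSpace.single 1 1) 2 * curl (v s) y 0) (t := t) (x := x) (v t x)
      (hX0t.fun_mul hW1t) (hX1t.fun_mul hW0t) (hX0x.mul hW1x) (hX1x.mul hW0x)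
    have e2 := material_mul (θ₁ := fun s y => fderiv ℝ (v s) y (EuclideanSpace.single 0 1) 2)
      (θ₂ := fun s y => curl (v s) y 1) (t := t) (x := x) (v t x) hX0t hW1t hX0x hW1x
    have e3 := material_mul (θ₁ := fun s y => fderiv ℝ (v s) y (EuclideanSpace.single 1 1) 2)
      (θ₂ := fun s y => curl (v s) y 0) (t := t) (x := x) (v t x) hX1t hW0t hX1x hW0x
    beta_reduce at e1 e2 e3
    rw [e1, e2, e3]
  have hLD : deriv (fun s => curl (v s) x 0 * curl (v s) x 0 + curl (v s) x 1 * curl (v s) x 1) t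
      + fderiv ℝ (fun y => curl (v t) y 0 * curl (v t) y 0 + curl (v t) y 1 * curl (v t) y 1) x (v t x)
      - Δ (fun y => curl (v t) y 0 * curl (v t) y 0 + curl (v t) y 1 * curl (v t) y 1) x =
      (curl (v t) x 0 *
          (deriv (fun s => curl (v s) x 0) t + fderiv ℝ (fun y => curl (v t) y 0) x (v t x) - Δ (fun y => curl (v t) y 0) x)
        + curl (v t) x 0 *
          (deriv (fun s => curl (v s) x 0) t + fderiv ℝ (fun y => curl (v t) y 0) x (v t x) - Δ (fun y => curl (v t) y 0) x)
        - 2 * ∑ i : Fin 3, fderiv ℝ (fun y => curl (v t) y 0) x (EuclideanSpace.single i 1) *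
            fderiv ℝ (fun y => curl (v t) y 0) x (EuclideanSpace.single i 1))
      + (curl (v t) x 1 *
          (deriv (fun s => curl (v s) x 1) t + fderiv ℝ (fun y => curl (v t) y 1) x (v t x) - Δ (fun y => curl (v t) y 1) x)
        + curl (v t) x 1 *
          (deriv (fun s => curl (v s) x 1) t + fderiv ℝ (fun y => curl (v t) y 1) x (v t x) - Δ (fun y => curl (v t) y 1) x)
        - 2 * ∑ i : Fin 3, fderiv ℝ (fun y => curl (v t) y 1) x (EuclideanSpace.single i 1) *
            fderiv ℝ (fun y => curl (v t) y 1) x (EuclideanSpace.single i 1)) := by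
    have e1 := material_add (θ₁ := fun s y => curl (v s) y 0 * curl (v s) y 0)
      (θ₂ := fun s y => curl (v s) y 1 * curl (v s) y 1) (t := t) (x := x) (v t x)
      (hW0t.fun_mul hW0t) (hW1t.fun_mul hW1t) (hW0x.mul hW0x) (hW1x.mul hW1x)
    have e2 := material_mul (θ₁ := fun s y => curl (v s) y 0) (θ₂ := fun s y => curl (v s) y 0) (t := t) (x := x)
      (v t x) hW0t hW0t hW0x hW0x
    have e3 := material_mul (θ₁ := fun s y => curl (v s) y 1) (θ₂ := fun s y => curl (v s) y 1) (t := t) (x := x)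
      (v t x) hW1t hW1t hW1x hW1x
    beta_reduce at e1 e2 e3
    rw [e1, e2, e3]
  have hgradN : ∀ w : EuclideanSpace ℝ (Fin 3),
      fderiv ℝ (fun y => fderiv ℝ (v t) y (EuclideanSpace.single 0 1) 2 * curl (v t) y 1 -
          fderiv ℝ (v t) y (EuclideanSpace.single 1 1) 2 * curl (v t) y 0) x w =
        (fderiv ℝ (v t) x (EuclideanSpace.single 0 1) 2 * fderiv ℝ (fun y => curl (v t) y 1) x w
          + curl (v t) x 1 * fderiv ℝ (fun y => fderiv ℝ (v t) y (EuclideanSpace.single 0 1) 2) x w)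
        - (fderiv ℝ (v t) x (EuclideanSpace.single 1 1) 2 * fderiv ℝ (fun y => curl (v t) y 0) x w
          + curl (v t) x 0 * fderiv ℝ (fun y => fderiv ℝ (v t) y (EuclideanSpace.single 1 1) 2) x w) := by
    intro w
    rw [fderiv_sub_coord (g₁ := fun y => fderiv ℝ (v t) y (EuclideanSpace.single 0 1) 2 * curl (v t) y 1)
        (g₂ := fun y => fderiv ℝ (v t) y (EuclideanSpace.single 1 1) 2 * curl (v t) y 0) (dX0.fun_mul dW1) (dX1.fun_mul dW0),
      fderiv_mul_coord dX0 dW1, fderiv_mul_coord dX1 dW0]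
  have hgradD : ∀ w : EuclideanSpace ℝ (Fin 3),
      fderiv ℝ (fun y => curl (v t) y 0 * curl (v t) y 0 + curl (v t) y 1 * curl (v t) y 1) x w =
        (curl (v t) x 0 * fderiv ℝ (fun y => curl (v t) y 0) x w + curl (v t) x 0 * fderiv ℝ (fun y => curl (v t) y 0) x w)
        + (curl (v t) x 1 * fderiv ℝ (fun y => curl (v t) y 1) x w + curl (v t) x 1 * fderiv ℝ (fun y => curl (v t) y 1) x w) := by
    intro w
    rw [fderiv_add_coord (g₁ := fun y => curl (v t) y 0 * curl (v t) y 0) (g₂ := fun y => curl (v t) y 1 * curl (v t) y 1)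
        (dW0.fun_mul dW0) (dW1.fun_mul dW1), fderiv_mul_coord dW0 dW0, fderiv_mul_coord dW1 dW1]
  -- ## the four transport laws at `(t,x)`
  have hLW0 := horizontalVorticity_equation hrate hcont hmild hdiv ht (hpol t ht) x 0
  have hLW1 := horizontalVorticity_equation hrate hcont hmild hdiv ht (hpol t ht) x 1
  obtain ⟨hLX0, hLX1⟩ := rotatedGradient_equation hrate hcont hmild hdiv ht (hpol t ht) x
  -- ## the frozen constraint `ω₀X₀ + ω₁X₁ ≡ 0` on the slice and its partial derivatives at `x`
  have hfro_fun : (fun y => curl (v t) y 0 * fderiv ℝ (v t) y (EuclideanSpace.single 0 1) 2 +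
      curl (v t) y 1 * fderiv ℝ (v t) y (EuclideanSpace.single 1 1) 2) = fun _ => (0 : ℝ) := by
    funext y
    have h := rotatedGradient_wedge_vorticity_eq_zero hrate hcont hmild hdiv hpol ht y
    linear_combination (-1 : ℝ) * h
  have hfro : curl (v t) x 0 * fderiv ℝ (v t) x (EuclideanSpace.single 0 1) 2 +
      curl (v t) x 1 * fderiv ℝ (v t) x (EuclideanSpace.single 1 1) 2 = 0 := congrFun hfro_fun x
  have hfro_k : ∀ w : EuclideanSpace ℝ (Fin 3),
      (curl (v t) x 0 * fderiv ℝ (fun y => fderiv ℝ (v t) y (EuclideanSpace.single 0 1) 2) x w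
        + fderiv ℝ (v t) x (EuclideanSpace.single 0 1) 2 * fderiv ℝ (fun y => curl (v t) y 0) x w)
      + (curl (v t) x 1 * fderiv ℝ (fun y => fderiv ℝ (v t) y (EuclideanSpace.single 1 1) 2) x w
        + fderiv ℝ (v t) x (EuclideanSpace.single 1 1) 2 * fderiv ℝ (fun y => curl (v t) y 1) x w) = 0 := by
    intro w
    have h := congrArg (fun g : EuclideanSpace ℝ (Fin 3) → ℝ => fderiv ℝ g x w) hfro_fun
    simp only at h
    rw [fderiv_add_coord (g₁ := fun y => curl (v t) y 0 * fderiv ℝ (v t) y (EuclideanSpace.single 0 1) 2)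
        (g₂ := fun y => curl (v t) y 1 * fderiv ℝ (v t) y (EuclideanSpace.single 1 1) 2) (dW0.fun_mul dX0) (dW1.fun_mul dX1),
      fderiv_mul_coord dW0 dX0, fderiv_mul_coord dW1 dX1, fderiv_fun_const] at h
    simpa using h
  -- ## substitute and close with the certified polynomial identity
  rw [hLN, hLD]
  simp only [hgradN, hgradD, Fin.sum_univ_three]
  rw [hLW0, hLW1, hLX0, hLX1]
  have hk0 := hfro_k (EuclideanSpace.single 0 1)
  have hk1 := hfro_k (EuclideanSpace.single 1 1)
  have hk2 := hfro_k (EuclideanSpace.single 2 1)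
  -- atoms
  generalize curl (v t) x 0 = W0 at *
  generalize curl (v t) x 1 = W1 at *
  generalize fderiv ℝ (v t) x (EuclideanSpace.single 0 1) 2 = X0 at *
  generalize fderiv ℝ (v t) x (EuclideanSpace.single 1 1) 2 = X1 at *
  generalize fderiv ℝ (v t) x (EuclideanSpace.single 0 1) 0 = d00 at *
  generalize fderiv ℝ (v t) x (EuclideanSpace.single 0 1) 1 = d01 at *
  generalize fderiv ℝ (v t) x (EuclideanSpace.single 1 1) 0 = d10 at *
  generalize fderiv ℝ (v t) x (EuclideanSpace.single 1 1) 1 = d11 at *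
  generalize fderiv ℝ (fun y => curl (v t) y 0) x (EuclideanSpace.single 0 1) = dW00 at *
  generalize fderiv ℝ (fun y => curl (v t) y 0) x (EuclideanSpace.single 1 1) = dW01 at *
  generalize fderiv ℝ (fun y => curl (v t) y 0) x (EuclideanSpace.single 2 1) = dW02 at *
  generalize fderiv ℝ (fun y => curl (v t) y 1) x (EuclideanSpace.single 0 1) = dW10 at *
  generalize fderiv ℝ (fun y => curl (v t) y 1) x (EuclideanSpace.single 1 1) = dW11 at *
  generalize fderiv ℝ (fun y => curl (v t) y 1) x (EuclideanSpace.single 2 1) = dW12 at *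
  generalize fderiv ℝ (fun y => fderiv ℝ (v t) y (EuclideanSpace.single 0 1) 2) x (EuclideanSpace.single 0 1) = dX00 at *
  generalize fderiv ℝ (fun y => fderiv ℝ (v t) y (EuclideanSpace.single 0 1) 2) x (EuclideanSpace.single 1 1) = dX01 at *
  generalize fderiv ℝ (fun y => fderiv ℝ (v t) y (EuclideanSpace.single 0 1) 2) x (EuclideanSpace.single 2 1) = dX02 at *
  generalize fderiv ℝ (fun y => fderiv ℝ (v t) y (EuclideanSpace.single 1 1) 2) x (EuclideanSpace.single 0 1) = dX10 at *
  generalize fderiv ℝ (fun y => fderiv ℝ (v t) y (EuclideanSpace.single 1 1) 2) x (EuclideanSpace.single 1 1) = dX11 at *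
  generalize fderiv ℝ (fun y => fderiv ℝ (v t) y (EuclideanSpace.single 1 1) 2) x (EuclideanSpace.single 2 1) = dX12 at *
  generalize fderiv ℝ (fun y => timeDerivWithin (Iio 0) v t y + convect (v t) (v t) y - Δ (v t) y) x
    (EuclideanSpace.single 0 1) 2 = F02 at *
  generalize fderiv ℝ (fun y => timeDerivWithin (Iio 0) v t y + convect (v t) (v t) y - Δ (v t) y) x
    (EuclideanSpace.single 1 1) 2 = F12 at *
  -- certificate (kit j263750): P = c·w − 2D Σₖ βₖ wₖ
  linear_combination
    (2 * (W0 * W0 + W1 * W1) * (W0 * (-W1 * d00 + W0 * d10) + W1 * (-W1 * d01 + W0 * d11))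
      + 2 * ((W0 * dW10 - W1 * dW00) * (2 * W0 * dW00 + 2 * W1 * dW10)
        + (W0 * dW11 - W1 * dW01) * (2 * W0 * dW01 + 2 * W1 * dW11)
        + (W0 * dW12 - W1 * dW02) * (2 * W0 * dW02 + 2 * W1 * dW12))
      + (W0 * W0 + W1 * W1) ^ 2 * (d01 - d10)) * hfro
    - 2 * (W0 * W0 + W1 * W1) * ((W0 * dW10 - W1 * dW00) * hk0 + (W0 * dW11 - W1 * dW01) * hk1
        + (W0 * dW12 - W1 * dW02) * hk2)

/-- **The slope law on the SEPARATED-PRESSURE stratum is source-free.**  If on the slice `t` the vertical component of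
the residual has no horizontal gradient (`(∂ₐf)₂ = 0` for `a ⟂ e₃`, i.e. `∇_h∂₂p(t,·) ≡ 0`), then with the notation of
`slopeLaw`: `D² 𝓛N − N D 𝓛D + Σₖ ∂ₖD (D ∂ₖN − N ∂ₖD) = 0` — K2-p1's law `|ω|²(∂ₜ + v·∇)Λ = div(|ω|²∇Λ)`
(K2P1-S2-NOTES §4) multiplied by `|ω|⁴`, valid through the zeros of `ω`. -/
theorem slopeLaw_of_separatedPressure (hrate : HasTypeITimeDecay C v)
    (hcont : ContinuousOn (uncurry v) (Iio (0 : ℝ) ×ˢ univ))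
    (hmild : ∀ s t : ℝ, s < t → t < 0 → ∀ x,
      v t x = UnboundedOperators.heatExtension (v s) (t - s) x - oseenDuhamel 1 s v v t x)
    (hdiv : ∀ t < 0, VectorCalculus.IsDivFree (v t))
    (hpol : ∀ s < 0, ∀ y, ⟪curl (v s) y, EuclideanSpace.single 2 1⟫_ℝ = 0) {t : ℝ} (ht : t < 0)
    (hsep : ∀ (x a : EuclideanSpace ℝ (Fin 3)), ⟪a, EuclideanSpace.single 2 1⟫_ℝ = 0 →
      fderiv ℝ (fun y => timeDerivWithin (Iio 0) v t y + convect (v t) (v t) y - Δ (v t) y) x a 2 = 0)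
    (x : EuclideanSpace ℝ (Fin 3)) (W₀ W₁ X₀ X₁ N D : ℝ → EuclideanSpace ℝ (Fin 3) → ℝ)
    (hW₀ : ∀ s y, W₀ s y = curl (v s) y 0) (hW₁ : ∀ s y, W₁ s y = curl (v s) y 1)
    (hX₀ : ∀ s y, X₀ s y = fderiv ℝ (v s) y (EuclideanSpace.single 0 1) 2)
    (hX₁ : ∀ s y, X₁ s y = fderiv ℝ (v s) y (EuclideanSpace.single 1 1) 2)
    (hN : ∀ s y, N s y = X₀ s y * W₁ s y - X₁ s y * W₀ s y)
    (hD : ∀ s y, D s y = W₀ s y * W₀ s y + W₁ s y * W₁ s y) :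
    D t x ^ 2 * (deriv (fun s => N s x) t + fderiv ℝ (N t) x (v t x) - Δ (N t) x)
      - N t x * D t x * (deriv (fun s => D s x) t + fderiv ℝ (D t) x (v t x) - Δ (D t) x)
      + ∑ k : Fin 3, fderiv ℝ (D t) x (EuclideanSpace.single k 1) *
          (D t x * fderiv ℝ (N t) x (EuclideanSpace.single k 1) - N t x * fderiv ℝ (D t) x (EuclideanSpace.single k 1)) =
    0 := by
  have h0 : ⟪(EuclideanSpace.single 0 1 : EuclideanSpace ℝ (Fin 3)), EuclideanSpace.single 2 1⟫_ℝ = 0 := by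
    simp [EuclideanSpace.inner_single_left]
  have h1 : ⟪(EuclideanSpace.single 1 1 : EuclideanSpace ℝ (Fin 3)), EuclideanSpace.single 2 1⟫_ℝ = 0 := by
    simp [EuclideanSpace.inner_single_left]
  rw [slopeLaw hrate hcont hmild hdiv hpol ht x W₀ W₁ X₀ X₁ N D hW₀ hW₁ hX₀ hX₁ hN hD, hsep x _ h0, hsep x _ h1]
  ring

end Summit.NavierStokesRegularity.NavierStokesRegularity.Theorems.PoloidalWindowDoorPoloidalWindowRigiditySlopeLaw

end
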